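import Literature.Geometry.Lorentzian.ExtremalKerrThresholdRadial
import Literature.Geometry.Lorentzian.TeukolskyOutgoingExpansion
import Mathlib.Analysis.Calculus.Deriv.Shift
import HarnessLib

/-!
# Extremal Kerr at the superradiant threshold, II: the far equation is the Coulomb wave equation
# (`η = −m`, `L = −½ ± iδ`), i.e. Whittaker's equation with `κ = im`, `μ = ±iδ`

Continuation of `ExtremalKerrThresholdRadial.lean`, which shows that at `(a, ω) = (M, m/2M)` the scalar
radial Teukolsky equation (Teixeira da Costa's `λ`) is
  `(r − M)²R″ + 2(r − M)R′ + (m²(r + M)²/(4M²) + 3m²/4 − λ)R = 0`  on `r > M`                 (∗)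
and stops at its EULER FACE `r → M⁺`. Here the WHOLE equation is transformed. With `y = r − M > 0`,
`F(y) = y·R(M + y)` (`F′ = R + yR′`, `F″ = 2R′ + yR″`, `y·F″ = y²R″ + 2yR′`) and
`m²(y + 2M)²/(4M²) = (m/2M)²y² + (m²/M)y + m²`, (∗) becomes
  `F″ + [ (m/2M)² + (m²/M)/y + (7m²/4 − λ)/y² ] F = 0`  on `y > 0`                               (F)
(`coulombForm_of_extremal_threshold`), and in `ρ = ω_c y`, `ω_c = m/2M` (`m, M > 0`; `m < 0` is the image
under `(ω, m) ↦ (−ω, −m)`), `G(ρ) = F(ρ/ω_c)`, since `(m²/M)/ω_c = 2m`,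
  `G″ + [ 1 + 2m/ρ − (λ − 7m²/4)/ρ² ] G = 0`  on `ρ > 0`                                          (C)
(`coulomb_rescale`, `coulombWave_of_extremal_threshold`; from `Kerr.IsRadialTeukolskySolution`:
`coulombWave_of_isRadialTeukolskySolution`): the COULOMB WAVE EQUATION `w″ + (1 − 2η/ρ − L(L+1)/ρ²)w = 0`
(DLMF 33.2.1) with ATTRACTIVE Sommerfeld parameter `η = −m` and complex angular momentum
`L(L+1) = λ − 7m²/4`, `L = −½ ± iδ`, `δ² = 7m²/4 − ¼ − λ` (`coulombL_iff`; the exponents of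
`euler_face_exponents`). Sanity: `ρ²·(coefficient of (C))` at `ρ = 0` is the horizon coefficient
`7m²/4 − λ = δ² + ¼` of (∗) (`coulombCoeff_mul_sq`, `coeff_extremal_threshold_at_horizon`), and the
coefficient `→ 1` at `ρ → ∞` (`tendsto_coulombCoeff_atTop`): asymptotically free with a Coulomb tail.
Under `z = −2iρ` (`(dρ/dz)² = −¼`, `1/ρ = −2i/z`) the coefficient of (C) becomes Whittaker's
`−¼ + κ/z + (¼ − μ²)/z²` (DLMF 13.14.1) with `κ = im`, `μ² = ¼ + L(L+1) = λ + ¼ − 7m²/4 = −δ²`, `μ = ±iδ`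
(`whittakerCoeff_of_coulombCoeff`, `whittaker_params_of_extremal_threshold`) — COEFFICIENT ALGEBRA ONLY:
the tree has no complex-variable ODE vocabulary and none is faked. Finally `2Mω_c = m`: Teixeira da
Costa's outgoing phase `e^{iωr + 2iMω log r}` at `ω_c` is `e^{i(ω_c r + m log r)}`
(`outgoingPhase_extremal_threshold`).

PURE CALCULUS AND ALGEBRA; NOTHING ASYMPTOTIC OR SPECIAL-FUNCTION-THEORETIC IS CLAIMED. Recorded for the
planner, NOT proved (tree and Mathlib lack Whittaker functions, their ODE, the asymptotics DLMF 13.14.21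
and the connection formula 13.14.33), is what the matching of Teukolsky–Press 1974 §III / GZZ 2016 §2.2
draws from it: (i) the solution of (C) outgoing at infinity is `H⁺_L(η, ρ) ∝ W_{im, iδ}(−2iρ) ~
e^{i(ρ + m log 2ρ)}` (DLMF §33.2(iii), 13.14.21), Teixeira da Costa's `R_𝓘⁺` at the corner up to a
constant phase (`ρ + m log 2ρ = ω_c r + m log(r − M) + const`); (ii) by the connection formula
`W_{κ,μ} = Γ(−2μ)/Γ(½ − μ − κ)·M_{κ,μ} + Γ(2μ)/Γ(½ + μ − κ)·M_{κ,−μ}`, `M_{κ,±μ}(z) ~ z^{½ ± μ}`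
(DLMF 13.14.33, `2μ ∉ ℤ`), its data at `ρ → 0` over `ρ^{½ ± iδ}` are
`Γ(∓2iδ)/Γ(½ ∓ iδ − im)·(−2i)^{½ ± iδ}` — the far Gamma factors `Γ(∓2iδ)/Γ(½ ∓ iδ − im)` of
Teukolsky–Press's incident amplitude `Z^in` (GZZ 2016 §2.2; tree: `tpCoeff` in
`TeukolskyPressNearExtremalAmplitudes.lean`); (iii) hence (`|Γ(½ + it)|² = π/cosh πt`,
`|(−2i)^{±iδ}| = e^{±πδ/2}`) the far reflection coefficient of the corner model is
`|ρ_far|² = e^{−2πδ}·cosh π(m − δ)/cosh π(m + δ) < 1` (`m, δ > 0`; this sign of the exponent is the one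
consistent with the constant flux `δ(|C|² − |D|²) = |A|²` of (C)), `→ 1` only as `δ → 0`; and in the
Breitenlohner–Freedman-stable sectors (`δ² < 0`, `μ = ν > 0`) the coefficient `Γ(2ν)/Γ(½ + ν − im)` of
the dominant branch `z^{½ − ν}` never vanishes for `m ≠ 0`: the corner far solution is never purely
recessive at `y → 0`.

References: DLMF 33.2.1, §33.2(iii), 13.14.1, 13.14.21, 13.14.33 [DLMF]; S. A. Teukolsky, W. H. Press,
ApJ 193 (1974) 443, §III [TeukolskyPress1974]; S. E. Gralla, A. Zimmerman, P. Zimmerman, PRD 94 (2016)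
084017 = arXiv:1608.04739, §2.2 [GrallaZimmermanZimmerman2016]; R. Teixeira da Costa, arXiv:1910.02854,
Def. 2.3 [Costa2019].
-/

noncomputable section

open Complex Filter Topology

namespace Literature.Geometry.Lorentzian.Kerr.TeukolskyPress

/-! ### From (∗) to the normal form (F): `F(y) = y·R(M + y)` -/

/-- **(∗) ⟹ (F), pointwise.** If `R` (pointwise derivatives `R′`, `R″`) solves (∗) on `r > M` — the
right-hand side of `isRadialTeukolskySolution_extremal_threshold_iff` — then `F(y) = y·R(M + y)` has
`F′ = R(M+y) + yR′(M+y)`, `F″ = 2R′(M+y) + yR″(M+y)` and `F″ + [(m/2M)² + (m²/M)/y + (7m²/4 − λ)/y²]F = 0`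
at every `y > 0` (`y·F″ = y²R″ + 2yR′`, `m²(y + 2M)²/(4M²) + 3m²/4 = (m/2M)²y² + (m²/M)y + 7m²/4`). [folklore] -/
theorem coulombForm_of_extremal_threshold {M : ℝ} (hM : M ≠ 0) (m lam : ℝ) {R R' R'' : ℝ → ℂ}
    (hR : ∀ r : ℝ, M < r →
      HasDerivAt R (R' r) r ∧ HasDerivAt R' (R'' r) r ∧
        (((r - M) ^ 2 : ℝ) : ℂ) * R'' r + 2 * ((r - M : ℝ) : ℂ) * R' r +
          ((m ^ 2 * (r + M) ^ 2 / (4 * M ^ 2) + 3 * m ^ 2 / 4 - lam : ℝ) : ℂ) * R r = 0)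
    {y : ℝ} (hy : 0 < y) :
    HasDerivAt (fun t : ℝ => (t : ℂ) * R (M + t)) (R (M + y) + (y : ℂ) * R' (M + y)) y ∧
    HasDerivAt (fun t : ℝ => R (M + t) + (t : ℂ) * R' (M + t))
        (2 * R' (M + y) + (y : ℂ) * R'' (M + y)) y ∧
    2 * R' (M + y) + (y : ℂ) * R'' (M + y) +
      (((m / (2 * M)) ^ 2 + m ^ 2 / M / y + (7 * m ^ 2 / 4 - lam) / y ^ 2 : ℝ) : ℂ) *
        ((y : ℂ) * R (M + y)) = 0 := by
  obtain ⟨h1, h2, h3⟩ := hR (M + y) (lt_add_of_pos_right M hy)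
  have h0 : HasDerivAt (fun t : ℝ => (t : ℂ)) 1 y := by simpa using (hasDerivAt_id y).ofReal_comp
  have hs1 : HasDerivAt (fun t : ℝ => R (M + t)) (R' (M + y)) y := h1.comp_const_add M y
  have hs2 : HasDerivAt (fun t : ℝ => R' (M + t)) (R'' (M + y)) y := h2.comp_const_add M y
  refine ⟨(h0.mul hs1).congr_deriv (by ring), (hs1.add (h0.mul hs2)).congr_deriv (by ring), ?_⟩
  have hy' : (y : ℂ) ≠ 0 := by exact_mod_cast hy.ne'
  have hM' : (M : ℂ) ≠ 0 := by exact_mod_cast hM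
  have key : (2 * R' (M + y) + (y : ℂ) * R'' (M + y) +
      (((m / (2 * M)) ^ 2 + m ^ 2 / M / y + (7 * m ^ 2 / 4 - lam) / y ^ 2 : ℝ) : ℂ) *
        ((y : ℂ) * R (M + y))) * (y : ℂ) =
      (((M + y - M) ^ 2 : ℝ) : ℂ) * R'' (M + y) + 2 * ((M + y - M : ℝ) : ℂ) * R' (M + y) +
        ((m ^ 2 * (M + y + M) ^ 2 / (4 * M ^ 2) + 3 * m ^ 2 / 4 - lam : ℝ) : ℂ) * R (M + y) := by
    push_cast; field_simp; ring
  exact (mul_eq_zero.1 (key.trans h3)).resolve_right hy'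

/-! ### The Coulomb wave equation (C) -/

/-- **Rescaling to unit wavenumber.** If `F″ + (w² + A/y + B/y²)F = 0` on `y > 0` (pointwise derivatives
`F′`, `F″`; `w > 0`), then `G(ρ) = F(ρ/w)` has `G′ = F′(ρ/w)/w`, `G″ = F″(ρ/w)/w²` and solves
`G″ + (1 + (A/w)/ρ + B/ρ²)G = 0` on `ρ > 0` (chain rule for the real scaling `ρ ↦ ρ/w`). [folklore] -/
theorem coulomb_rescale {w A B : ℝ} (hw : 0 < w) {F F' F'' : ℝ → ℂ}
    (hF : ∀ y : ℝ, 0 < y → HasDerivAt F (F' y) y ∧ HasDerivAt F' (F'' y) y ∧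
      F'' y + ((w ^ 2 + A / y + B / y ^ 2 : ℝ) : ℂ) * F y = 0)
    {ρ : ℝ} (hρ : 0 < ρ) :
    HasDerivAt (fun t : ℝ => F (t / w)) (F' (ρ / w) / w) ρ ∧
    HasDerivAt (fun t : ℝ => F' (t / w) / w) (F'' (ρ / w) / w ^ 2) ρ ∧
    F'' (ρ / w) / w ^ 2 + ((1 + A / w / ρ + B / ρ ^ 2 : ℝ) : ℂ) * F (ρ / w) = 0 := by
  obtain ⟨h1, h2, h3⟩ := hF (ρ / w) (div_pos hρ hw)
  have hh : HasDerivAt (fun t : ℝ => t / w) (1 / w) ρ := (hasDerivAt_id' ρ).div_const w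
  have hw' : (w : ℂ) ≠ 0 := by exact_mod_cast hw.ne'
  have hρ' : (ρ : ℂ) ≠ 0 := by exact_mod_cast hρ.ne'
  have e1 : (1 / w : ℝ) • F' (ρ / w) = F' (ρ / w) / w := by
    rw [Complex.real_smul]; push_cast; ring
  have e2 : ((1 / w : ℝ) • F'' (ρ / w)) / (w : ℂ) = F'' (ρ / w) / w ^ 2 := by
    rw [Complex.real_smul]; push_cast; ring
  refine ⟨(h1.scomp ρ hh).congr_deriv e1, ((h2.scomp ρ hh).div_const (w : ℂ)).congr_deriv e2, ?_⟩
  have key : F'' (ρ / w) / w ^ 2 + ((1 + A / w / ρ + B / ρ ^ 2 : ℝ) : ℂ) * F (ρ / w) =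
      (1 / (w : ℂ) ^ 2) *
        (F'' (ρ / w) + ((w ^ 2 + A / (ρ / w) + B / (ρ / w) ^ 2 : ℝ) : ℂ) * F (ρ / w)) := by
    push_cast; field_simp
  rw [key, h3, mul_zero]

/-- **The far equation of extremal Kerr at the threshold is the Coulomb wave equation.** For `M, m > 0`,
`ω = ω_c = m/2M`: if `F″ + [ω² + (m²/M)/y + (7m²/4 − λ)/y²]F = 0` on `y > 0` (the normal form (F) of (∗),
`coulombForm_of_extremal_threshold`), then `G(ρ) = F(ρ/ω)` (`G′ = F′(ρ/ω)/ω`, `G″ = F″(ρ/ω)/ω²`) solves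
`G″ + [1 + 2m/ρ − (λ − 7m²/4)/ρ²]G = 0` on `ρ > 0`: the Coulomb wave equation
`w″ + (1 − 2η/ρ − L(L+1)/ρ²)w = 0` with `η = −m`, `L(L+1) = λ − 7m²/4` (`L = −½ ± iδ`, `coulombL_iff`).
[cite: DLMF, 33.2.1] -/
theorem coulombWave_of_extremal_threshold {M m ω : ℝ} (hM : 0 < M) (hm : 0 < m) (hω : ω = m / (2 * M))
    (lam : ℝ) {F F' F'' : ℝ → ℂ}
    (hF : ∀ y : ℝ, 0 < y → HasDerivAt F (F' y) y ∧ HasDerivAt F' (F'' y) y ∧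
      F'' y + ((ω ^ 2 + m ^ 2 / M / y + (7 * m ^ 2 / 4 - lam) / y ^ 2 : ℝ) : ℂ) * F y = 0)
    {ρ : ℝ} (hρ : 0 < ρ) :
    HasDerivAt (fun t : ℝ => F (t / ω)) (F' (ρ / ω) / ω) ρ ∧
    HasDerivAt (fun t : ℝ => F' (t / ω) / ω) (F'' (ρ / ω) / ω ^ 2) ρ ∧
    F'' (ρ / ω) / ω ^ 2 + ((1 + 2 * m / ρ - (lam - 7 * m ^ 2 / 4) / ρ ^ 2 : ℝ) : ℂ) * F (ρ / ω) = 0 := by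
  have hω0 : 0 < ω := by rw [hω]; positivity
  obtain ⟨g1, g2, g3⟩ := coulomb_rescale (A := m ^ 2 / M) (B := 7 * m ^ 2 / 4 - lam) hω0 hF hρ
  refine ⟨g1, g2, ?_⟩
  have e : (1 + m ^ 2 / M / ω / ρ + (7 * m ^ 2 / 4 - lam) / ρ ^ 2 : ℝ) =
      1 + 2 * m / ρ - (lam - 7 * m ^ 2 / 4) / ρ ^ 2 := by
    have := hM.ne'; have := hm.ne'; have := hρ.ne'; rw [hω]; field_simp; ring
  rw [← e]; exact g3

/-- **(∗) ⟹ (C), packaged.** For `M, m > 0`, `ω = m/2M`: if `R` is a classical solution of the scalar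
radial Teukolsky equation of extremal Kerr (`a = M`) at the threshold frequency `ω`
(`Kerr.IsRadialTeukolskySolution`, Teixeira da Costa's `λ`), then `G(ρ) = (ρ/ω)·R(M + ρ/ω)` is twice differentiable on `ρ > 0` and solves the
Coulomb wave equation `G″ + [1 + 2m/ρ − (λ − 7m²/4)/ρ²]G = 0` there (`η = −m`, `L(L+1) = λ − 7m²/4`) — the
far-zone equation of the Teukolsky–Press matching at the extremal corner. [cite: TeukolskyPress1974, Section III] -/
theorem coulombWave_of_isRadialTeukolskySolution {M m ω : ℝ} (hM : 0 < M) (hm : 0 < m)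
    (hω : ω = m / (2 * M)) (lam : ℝ) {R : ℝ → ℂ} (hR : IsRadialTeukolskySolution M M 0 ω m lam R) :
    ∃ G' G'' : ℝ → ℂ, ∀ ρ : ℝ, 0 < ρ →
      HasDerivAt (fun t : ℝ => ((t / ω : ℝ) : ℂ) * R (M + t / ω)) (G' ρ) ρ ∧
      HasDerivAt G' (G'' ρ) ρ ∧
      G'' ρ + ((1 + 2 * m / ρ - (lam - 7 * m ^ 2 / 4) / ρ ^ 2 : ℝ) : ℂ) *
        (((ρ / ω : ℝ) : ℂ) * R (M + ρ / ω)) = 0 := by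
  subst hω
  obtain ⟨R', R'', h⟩ := (isRadialTeukolskySolution_extremal_threshold_iff hM m lam R).1 hR
  exact ⟨_, _, fun ρ hρ => coulombWave_of_extremal_threshold (F := fun t : ℝ => (t : ℂ) * R (M + t))
    (F' := fun t : ℝ => R (M + t) + (t : ℂ) * R' (M + t))
    (F'' := fun t : ℝ => 2 * R' (M + t) + (t : ℂ) * R'' (M + t)) hM hm rfl lam
    (fun y hy => coulombForm_of_extremal_threshold hM.ne' m lam h hy) hρ⟩

/-- **The complex angular momentum.** With `δ² = 7m²/4 − ¼ − λ` (GZZ 2016 eq. (10), `s = 0`):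
`L(L+1) = λ − 7m²/4` iff `L = −½ ± iδ` — the `L` of (C) read as `w″ + (1 − 2η/ρ − L(L+1)/ρ²)w = 0`; the
exponents of `euler_face_exponents` (`G ~ ρ^{L+1} = ρ^{½ ± iδ}`). [cite: GrallaZimmermanZimmerman2016, Section 2.2 eq. (10)] -/
theorem coulombL_iff (m lam : ℝ) {δ : ℂ} (hδ : δ ^ 2 = 7 * (m : ℂ) ^ 2 / 4 - 1 / 4 - lam) (L : ℂ) :
    L * (L + 1) = lam - 7 * (m : ℂ) ^ 2 / 4 ↔ L = -(1 / 2 : ℂ) + δ * I ∨ L = -(1 / 2 : ℂ) - δ * I := by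
  have key : L * (L + 1) = lam - 7 * (m : ℂ) ^ 2 / 4 ↔ (L + 1 / 2) ^ 2 = (δ * I) ^ 2 := by
    constructor <;> intro h
    · linear_combination h + hδ - δ ^ 2 * Complex.I_sq
    · linear_combination h - hδ + δ ^ 2 * Complex.I_sq
  rw [key, sq_eq_sq_iff_eq_or_eq_neg]
  constructor <;> rintro (h | h)
  · exact Or.inl (by linear_combination h)
  · exact Or.inr (by linear_combination h)
  · exact Or.inl (by linear_combination h)
  · exact Or.inr (by linear_combination h)

/-- Sanity for (C) at `ρ → 0`: `ρ²·[1 + 2m/ρ − (λ − 7m²/4)/ρ²] = ρ² + 2mρ + (7m²/4 − λ)`, whose value at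
`ρ = 0` is the horizon coefficient `7m²/4 − λ = δ² + ¼ = −L(L+1)` of (∗) (`coeff_extremal_threshold_at_horizon`;
a regular singular point with the Euler-face exponents shifted by one, `G = ρ·R/ω_c`). [folklore] -/
theorem coulombCoeff_mul_sq (m lam : ℝ) {ρ : ℝ} (hρ : ρ ≠ 0) :
    ρ ^ 2 * (1 + 2 * m / ρ - (lam - 7 * m ^ 2 / 4) / ρ ^ 2) = ρ ^ 2 + 2 * m * ρ + (7 * m ^ 2 / 4 - lam) := by
  field_simp
  ring

/-- Sanity for (C) at `ρ → ∞`: the coefficient `1 + 2m/ρ − (λ − 7m²/4)/ρ²` tends to `1` — an asymptotically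
free far field with an attractive Coulomb tail `2m/ρ` (whence the logarithmic phase `m log 2ρ`). [folklore] -/
theorem tendsto_coulombCoeff_atTop (m lam : ℝ) :
    Tendsto (fun ρ : ℝ => 1 + 2 * m / ρ - (lam - 7 * m ^ 2 / 4) / ρ ^ 2) atTop (𝓝 1) := by
  have h1 : Tendsto (fun ρ : ℝ => 2 * m / ρ) atTop (𝓝 0) :=
    tendsto_const_nhds.div_atTop tendsto_id
  have h2 : Tendsto (fun ρ : ℝ => (lam - 7 * m ^ 2 / 4) / ρ ^ 2) atTop (𝓝 0) :=
    tendsto_const_nhds.div_atTop (tendsto_pow_atTop two_ne_zero)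
  simpa using (tendsto_const_nhds (x := (1 : ℝ))).add h1 |>.sub h2

/-! ### Whittaker parameters under `z = −2iρ` (coefficient algebra only) -/

/-- **Coulomb ⟶ Whittaker, at the level of coefficients.** Under `z = −2iρ`: `ρ = (−2i)⁻¹z`,
`d²/dz² = (−2i)⁻²·d²/dρ²`, so `G″ = −c(ρ)G` reads `W″ = −(−2i)⁻²c·W`; for the Coulomb coefficient
`c = 1 + 2m/ρ − L(L+1)/ρ²` (`L2` stands for `L(L+1)`), `(−2i)⁻²·c = −¼ + κ/z + (¼ − μ²)/z²` with `κ = im`,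
`μ² = ¼ + L(L+1)`: the coefficient of WHITTAKER's equation (only this algebra is asserted). [cite: DLMF, 13.14.1] -/
theorem whittakerCoeff_of_coulombCoeff (m L2 : ℝ) {ρ : ℝ} (hρ : ρ ≠ 0) :
    ((-2 * I)⁻¹) ^ 2 * ((1 + 2 * m / ρ - L2 / ρ ^ 2 : ℝ) : ℂ) =
      -1 / 4 + I * m / (-2 * I * ρ) + (1 / 4 - (1 / 4 + (L2 : ℂ))) / (-2 * I * ρ) ^ 2 := by
  have hρ' : (ρ : ℂ) ≠ 0 := by exact_mod_cast hρ
  have hI2 : ((-2 * I)⁻¹) ^ 2 = -(1 / 4 : ℂ) := by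
    rw [inv_pow, mul_pow, Complex.I_sq]; norm_num
  have hz2 : (-2 * I * (ρ : ℂ)) ^ 2 = -4 * (ρ : ℂ) ^ 2 := by
    rw [mul_pow, mul_pow, Complex.I_sq]; ring
  have hκ : I * (m : ℂ) / (-2 * I * ρ) = (m : ℂ) / (-2 * ρ) := by
    rw [show (-2 * I * (ρ : ℂ)) = I * (-2 * ρ) by ring, mul_div_mul_left _ _ I_ne_zero]
  rw [hI2, hz2, hκ]
  push_cast
  field_simp
  ring

/-- **Whittaker parameters of the extremal threshold.** With `δ² = 7m²/4 − ¼ − λ` and `L(L+1) = λ − 7m²/4`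
(`coulombL_iff`), the `μ` of `whittakerCoeff_of_coulombCoeff` satisfies `¼ − μ² = 7m²/4 − λ` iff
`μ² = −δ²` iff `μ = ±iδ`; with `κ = im` the corner far equation is Whittaker's equation for
`W_{im, ±iδ}(−2iρ)` (algebra only; the unproved consequences are in the module docstring). [cite: DLMF, 13.14.1] -/
theorem whittaker_params_of_extremal_threshold (m lam : ℝ) {δ : ℂ}
    (hδ : δ ^ 2 = 7 * (m : ℂ) ^ 2 / 4 - 1 / 4 - lam) (μ : ℂ) :
    ((1 / 4 : ℂ) - μ ^ 2 = 7 * (m : ℂ) ^ 2 / 4 - lam ↔ μ ^ 2 = -δ ^ 2) ∧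
    (μ ^ 2 = -δ ^ 2 ↔ μ = δ * I ∨ μ = -(δ * I)) := by
  refine ⟨⟨fun h => by linear_combination hδ - h, fun h => by linear_combination hδ - h⟩, ?_⟩
  have e : -δ ^ 2 = (δ * I) ^ 2 := by linear_combination -δ ^ 2 * Complex.I_sq
  rw [e, sq_eq_sq_iff_eq_or_eq_neg]

/-! ### Bookkeeping against Teixeira da Costa's outgoing normalisation -/

/-- `2M·ω_c = m`: at the corner frequency `ω_c = m/2M` Teixeira da Costa's outgoing phase
`e^{iωr + 2iMω log r}` (`Costa2019.outgoingPhase`) is `e^{i(ω_c r + m log r)}` — the logarithmic phase of the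
attractive Coulomb problem (C), `η = −m` (outgoing wave `e^{i(ρ + m log 2ρ + const)}`, `ρ = ω_c(r − M)`;
that asymptotic identification is not made here). [folklore] -/
theorem outgoingPhase_extremal_threshold {M : ℝ} (hM : M ≠ 0) (m r : ℝ) :
    Costa2019.outgoingPhase M (m / (2 * M)) r =
      Complex.exp (I * ((m / (2 * M) : ℝ) : ℂ) * r + I * m * Real.log r) := by
  unfold Costa2019.outgoingPhase
  congr 1
  have hM' : (M : ℂ) ≠ 0 := by exact_mod_cast hM
  push_cast
  field_simp

end Literature.Geometry.Lorentzian.Kerr.TeukolskyPress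

end
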